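import Mathlib
import HarnessLib
import Literature.NumberTheory.Transcendental.MultipleZetaThreeOneProofs

/-!
# `KernelModuloPeriodConjecture`, line `Sketch`: the BBBL alternating shuffle identity over any ring

Crux `FurushoPentagon.KernelModuloPeriodConjecture` (stmt-KontsevichZagierPeriods-15058), line
`Sketch`, registered stub `stub_shuffleTwosAlternating` (stub (v) of the lead's skeleton: the
combinatorial input for the infinite family `ζ(3,1,…,3,1)` of the algebraic leaf). It is the
shuffle-algebra identity of Borwein–Bradley–Broadhurst–Lisoněk ([BBBL1998], §4 Corollary 1)

  `∑_{r=-n}^{n} (-1)ʳ (AB)^{n-r} ш (AB)^{n+r} = 4ⁿ (A²B²)ⁿ`  in `ℤ⟨A,B⟩`,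

stated as an identity between the sums of an ARBITRARY test function `f : List Bool → R` with values
in an arbitrary commutative ring `R` over the shuffle lists (multiplicities included), with
`(AB)ᵖ = MZV.binaryWord {2}ᵖ` and `(A²B²)ⁿ = MZV.binaryWord {3,1}ⁿ` (`false = A = x₀`,
`true = B = x₁`).  The tree proves it for `ℝ`-valued `f` (`MZV.sum_shuffleWord_twos_alternating`, file
`Literature/NumberTheory/Transcendental/MultipleZetaThreeOneProofs.lean`); the proof there is
ring-generic and is copied here verbatim with `ℝ ↦ R`: by induction on `p + q` from the first-letter
recursion `(au) ш (bv) = a(u ш bv) + b(au ш v)` (`MZV.shuffleWord_cons_cons`), writing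
`σ_m = ∑_{p+q=m} (-1)^q (AB)ᵖ ш (AB)^q` and `π_m = ∑_{p+q=m} (-1)^q B(AB)ᵖ ш B(AB)^q`, one gets
`π_m = 2 B² σ_m`, `σ_{m+2} = -4 A²B² σ_m`, `σ₀ = 1` (prefixes acting on `f` by composition).

References: J. M. Borwein, D. M. Bradley, D. J. Broadhurst, P. Lisoněk, *Combinatorial aspects of
multiple zeta values*, Electron. J. Combin. **5** (1998), R38, §4 Proposition 1 and Corollary 1
[BBBL1998].
-/

namespace Summit.KontsevichZagierPeriods.FurushoPentagon.KernelModuloPeriodConjecture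

open Literature.NumberTheory.Transcendental
open scoped BigOperators

section TwosAlt

variable {R : Type} [CommRing R] (f : List Bool → R)

/-- (I) `(AB)ᵖ⁺¹ ш (AB)^{q+1} = AB[(AB)ᵖ ш (AB)^{q+1} + (AB)ᵖ⁺¹ ш (AB)^q] + 2 A²[B(AB)ᵖ ш B(AB)^q]`,
for sums of an `R`-valued `f`. [cite: BBBL1998, §4 (proof of Proposition 1)] -/
theorem twosAlt_sum_shuffleWord_twos_succ_succ (p q : ℕ) :
    ((MZV.shuffleWord (MZV.binaryWord (List.replicate (p + 1) 2))
        (MZV.binaryWord (List.replicate (q + 1) 2))).map f).sum =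
      ((MZV.shuffleWord (MZV.binaryWord (List.replicate p 2))
          (MZV.binaryWord (List.replicate (q + 1) 2))).map (f ∘ List.cons false ∘ List.cons true)).sum +
      ((MZV.shuffleWord (MZV.binaryWord (List.replicate (p + 1) 2))
          (MZV.binaryWord (List.replicate q 2))).map (f ∘ List.cons false ∘ List.cons true)).sum +
      2 * ((MZV.shuffleWord (true :: MZV.binaryWord (List.replicate p 2))
          (true :: MZV.binaryWord (List.replicate q 2))).map (f ∘ List.cons false ∘ List.cons false)).sum := by
  simp only [MZV.binaryWord_replicate_two_succ, MZV.shuffleWord_cons_cons, List.map_append,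
    List.sum_append, List.map_map]
  simp only [Function.comp_def]
  ring

/-- (II) `B(AB)ᵖ ш B(AB)^q = B[(AB)ᵖ ш B(AB)^q] + B[B(AB)ᵖ ш (AB)^q]` (`R`-valued `f`). [folklore] -/
theorem twosAlt_sum_shuffleWord_B_twos (p q : ℕ) :
    ((MZV.shuffleWord (true :: MZV.binaryWord (List.replicate p 2))
        (true :: MZV.binaryWord (List.replicate q 2))).map f).sum =
      ((MZV.shuffleWord (MZV.binaryWord (List.replicate p 2))
          (true :: MZV.binaryWord (List.replicate q 2))).map (f ∘ List.cons true)).sum +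
      ((MZV.shuffleWord (true :: MZV.binaryWord (List.replicate p 2))
          (MZV.binaryWord (List.replicate q 2))).map (f ∘ List.cons true)).sum := by
  rw [MZV.shuffleWord_cons_cons, List.map_append, List.sum_append, List.map_map, List.map_map]

/-- (III) `(AB)ᵖ⁺¹ ш B(AB)^q = A[B(AB)ᵖ ш B(AB)^q] + B[(AB)ᵖ⁺¹ ш (AB)^q]` (`R`-valued `f`).
[folklore] -/
theorem twosAlt_sum_shuffleWord_twos_succ_B (p q : ℕ) :
    ((MZV.shuffleWord (MZV.binaryWord (List.replicate (p + 1) 2))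
        (true :: MZV.binaryWord (List.replicate q 2))).map f).sum =
      ((MZV.shuffleWord (true :: MZV.binaryWord (List.replicate p 2))
          (true :: MZV.binaryWord (List.replicate q 2))).map (f ∘ List.cons false)).sum +
      ((MZV.shuffleWord (MZV.binaryWord (List.replicate (p + 1) 2))
          (MZV.binaryWord (List.replicate q 2))).map (f ∘ List.cons true)).sum := by
  rw [MZV.binaryWord_replicate_two_succ, MZV.shuffleWord_cons_cons, List.map_append, List.sum_append,
    List.map_map, List.map_map]

/-- (III') `B(AB)ᵖ ш (AB)^{q+1} = B[(AB)ᵖ ш (AB)^{q+1}] + A[B(AB)ᵖ ш B(AB)^q]` (`R`-valued `f`).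
[folklore] -/
theorem twosAlt_sum_shuffleWord_B_twos_succ (p q : ℕ) :
    ((MZV.shuffleWord (true :: MZV.binaryWord (List.replicate p 2))
        (MZV.binaryWord (List.replicate (q + 1) 2))).map f).sum =
      ((MZV.shuffleWord (MZV.binaryWord (List.replicate p 2))
          (MZV.binaryWord (List.replicate (q + 1) 2))).map (f ∘ List.cons true)).sum +
      ((MZV.shuffleWord (true :: MZV.binaryWord (List.replicate p 2))
          (true :: MZV.binaryWord (List.replicate q 2))).map (f ∘ List.cons false)).sum := by
  conv_lhs => rw [MZV.binaryWord_replicate_two_succ, MZV.shuffleWord_cons_cons]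
  rw [List.map_append, List.sum_append, List.map_map, List.map_map,
    ← MZV.binaryWord_replicate_two_succ]

/-- `∑_{q ≤ m} (-1)^q [(AB)^{m-q} ш B(AB)^q]` in terms of `π_{m-1}` and `σ_m` (`R`-valued `f`).
[folklore] -/
theorem twosAlt_sum_alternating_T (m : ℕ) :
    ∑ q ∈ Finset.range (m + 1), (-1 : R) ^ q *
        ((MZV.shuffleWord (MZV.binaryWord (List.replicate (m - q) 2))
          (true :: MZV.binaryWord (List.replicate q 2))).map f).sum =
      ∑ q ∈ Finset.range m, (-1 : R) ^ q *
          ((MZV.shuffleWord (true :: MZV.binaryWord (List.replicate (m - 1 - q) 2))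
            (true :: MZV.binaryWord (List.replicate q 2))).map (f ∘ List.cons false)).sum +
        ∑ q ∈ Finset.range (m + 1), (-1 : R) ^ q *
          ((MZV.shuffleWord (MZV.binaryWord (List.replicate (m - q) 2))
            (MZV.binaryWord (List.replicate q 2))).map (f ∘ List.cons true)).sum := by
  rw [Finset.sum_range_succ, Finset.sum_range_succ, Nat.sub_self, MZV.binaryWord_replicate_two_zero,
    MZV.shuffleWord_nil_left, MZV.shuffleWord_nil_left, List.map_singleton, List.map_singleton,
    List.sum_singleton, List.sum_singleton, Function.comp_apply, ← add_assoc,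
    ← Finset.sum_add_distrib]
  congr 1
  refine Finset.sum_congr rfl fun q hq => ?_
  rw [Finset.mem_range] at hq
  rw [show m - q = m - 1 - q + 1 by omega, twosAlt_sum_shuffleWord_twos_succ_B]
  ring

/-- `∑_{q ≤ m} (-1)^q [B(AB)^{m-q} ш (AB)^q]` in terms of `σ_m` and `π_{m-1}` (`R`-valued `f`).
[folklore] -/
theorem twosAlt_sum_alternating_T' (m : ℕ) :
    ∑ q ∈ Finset.range (m + 1), (-1 : R) ^ q *
        ((MZV.shuffleWord (true :: MZV.binaryWord (List.replicate (m - q) 2))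
          (MZV.binaryWord (List.replicate q 2))).map f).sum =
      ∑ q ∈ Finset.range (m + 1), (-1 : R) ^ q *
          ((MZV.shuffleWord (MZV.binaryWord (List.replicate (m - q) 2))
            (MZV.binaryWord (List.replicate q 2))).map (f ∘ List.cons true)).sum -
        ∑ q ∈ Finset.range m, (-1 : R) ^ q *
          ((MZV.shuffleWord (true :: MZV.binaryWord (List.replicate (m - 1 - q) 2))
            (true :: MZV.binaryWord (List.replicate q 2))).map (f ∘ List.cons false)).sum := by
  rw [Finset.sum_range_succ', Finset.sum_range_succ' (fun q => (-1 : R) ^ q *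
    ((MZV.shuffleWord (MZV.binaryWord (List.replicate (m - q) 2))
      (MZV.binaryWord (List.replicate q 2))).map (f ∘ List.cons true)).sum)]
  simp only [Nat.sub_zero, MZV.binaryWord_replicate_two_zero, MZV.shuffleWord_nil_right,
    List.map_singleton, List.sum_singleton, Function.comp_apply, pow_zero, one_mul]
  have h : ∀ q ∈ Finset.range m, (-1 : R) ^ (q + 1) *
      ((MZV.shuffleWord (true :: MZV.binaryWord (List.replicate (m - (q + 1)) 2))
        (MZV.binaryWord (List.replicate (q + 1) 2))).map f).sum =
      (-1 : R) ^ (q + 1) * ((MZV.shuffleWord (MZV.binaryWord (List.replicate (m - (q + 1)) 2))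
        (MZV.binaryWord (List.replicate (q + 1) 2))).map (f ∘ List.cons true)).sum -
      (-1 : R) ^ q * ((MZV.shuffleWord (true :: MZV.binaryWord (List.replicate (m - 1 - q) 2))
        (true :: MZV.binaryWord (List.replicate q 2))).map (f ∘ List.cons false)).sum := by
    intro q _
    rw [twosAlt_sum_shuffleWord_B_twos_succ, show m - (q + 1) = m - 1 - q by omega]
    ring
  rw [Finset.sum_congr rfl h, Finset.sum_sub_distrib]
  ring

/-- **`π_m = 2 B² σ_m`** over `R`:
`∑_{q ≤ m} (-1)^q [B(AB)^{m-q} ш B(AB)^q] = 2 ∑_{q ≤ m} (-1)^q B²[(AB)^{m-q} ш (AB)^q]`.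
[cite: BBBL1998, §4 Corollary 1] -/
theorem twosAlt_sum_alternating_P (m : ℕ) :
    ∑ q ∈ Finset.range (m + 1), (-1 : R) ^ q *
        ((MZV.shuffleWord (true :: MZV.binaryWord (List.replicate (m - q) 2))
          (true :: MZV.binaryWord (List.replicate q 2))).map f).sum =
      2 * ∑ q ∈ Finset.range (m + 1), (-1 : R) ^ q *
          ((MZV.shuffleWord (MZV.binaryWord (List.replicate (m - q) 2))
            (MZV.binaryWord (List.replicate q 2))).map (f ∘ List.cons true ∘ List.cons true)).sum := by
  simp only [twosAlt_sum_shuffleWord_B_twos, mul_add, Finset.sum_add_distrib]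
  rw [twosAlt_sum_alternating_T (f ∘ List.cons true) m, twosAlt_sum_alternating_T' (f ∘ List.cons true) m]
  simp only [Function.comp_assoc]
  ring

omit f in
/-- The abstract telescoping behind `σ_{m+2} = -4 A²B² σ_m`, over `R`: if
`s(a+1,b+1) = s₁(a,b+1) + s₁(a+1,b) + 2 p(a,b)` and the four boundary values
`s(m+2,0) = s(0,m+2) = s₁(m+1,0) = s₁(0,m+1) = B` agree, then
`∑_{q ≤ m+2} (-1)^q s(m+2-q, q) = -2 ∑_{q ≤ m} (-1)^q p(m-q, q)`. [folklore] -/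
theorem twosAlt_alternating_sum_succ_succ (s s₁ p : ℕ → ℕ → R) (B : R) (m : ℕ)
    (hrec : ∀ a b, s (a + 1) (b + 1) = s₁ a (b + 1) + s₁ (a + 1) b + 2 * p a b)
    (hb1 : s (m + 2) 0 = B) (hb2 : s 0 (m + 2) = B) (hb3 : s₁ (m + 1) 0 = B)
    (hb4 : s₁ 0 (m + 1) = B) :
    ∑ q ∈ Finset.range (m + 2 + 1), (-1 : R) ^ q * s (m + 2 - q) q =
      -2 * ∑ q ∈ Finset.range (m + 1), (-1 : R) ^ q * p (m - q) q := by
  set W := ∑ q ∈ Finset.range (m + 1 + 1), (-1 : R) ^ q * s₁ (m + 1 - q) q with hW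
  have hU : W = -(∑ q ∈ Finset.range (m + 1), (-1 : R) ^ q * s₁ (m - q) (q + 1)) + B := by
    rw [hW, Finset.sum_range_succ']
    simp only [Nat.add_sub_add_right, Nat.sub_zero, pow_zero, one_mul, hb3, pow_succ, mul_neg_one,
      neg_mul, Finset.sum_neg_distrib]
  have hV : W = ∑ q ∈ Finset.range (m + 1), (-1 : R) ^ q * s₁ (m + 1 - q) q - (-1) ^ m * B := by
    rw [hW, Finset.sum_range_succ, Nat.sub_self, hb4, pow_succ]
    ring
  rw [Finset.sum_range_succ, Finset.sum_range_succ']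
  simp only [Nat.sub_zero, Nat.sub_self, pow_zero, one_mul, hb1, hb2]
  have h3 : ∀ q ∈ Finset.range (m + 1), (-1 : R) ^ (q + 1) * s (m + 2 - (q + 1)) (q + 1) =
      -((-1 : R) ^ q * (s₁ (m - q) (q + 1) + s₁ (m + 1 - q) q + 2 * p (m - q) q)) := by
    intro q hq
    rw [Finset.mem_range] at hq
    rw [show m + 2 - (q + 1) = m - q + 1 by omega, hrec, show m - q + 1 = m + 1 - q by omega,
      pow_succ]
    ring
  rw [Finset.sum_congr rfl h3, Finset.sum_neg_distrib]
  simp only [mul_add, Finset.sum_add_distrib]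
  have hUV : ∑ q ∈ Finset.range (m + 1), (-1 : R) ^ q * s₁ (m - q) (q + 1) +
      ∑ q ∈ Finset.range (m + 1), (-1 : R) ^ q * s₁ (m + 1 - q) q = B + (-1) ^ m * B := by
    linear_combination hU - hV
  have hp : ∑ x ∈ Finset.range (m + 1), (-1 : R) ^ x * (2 * p (m - x) x) =
      2 * ∑ q ∈ Finset.range (m + 1), (-1 : R) ^ q * p (m - q) q := by
    rw [Finset.mul_sum]
    exact Finset.sum_congr rfl fun q _ => by ring
  linear_combination -hUV - hp

/-- **`σ_{m+2} = -4 A²B² σ_m`** over `R`: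
`∑_{q ≤ m+2} (-1)^q [(AB)^{m+2-q} ш (AB)^q] = -4 ∑_{q ≤ m} (-1)^q A²B²[(AB)^{m-q} ш (AB)^q]`.
[cite: BBBL1998, §4 Corollary 1] -/
theorem twosAlt_sum_alternating_S_succ_succ (m : ℕ) :
    ∑ q ∈ Finset.range (m + 2 + 1), (-1 : R) ^ q *
        ((MZV.shuffleWord (MZV.binaryWord (List.replicate (m + 2 - q) 2))
          (MZV.binaryWord (List.replicate q 2))).map f).sum =
      -4 * ∑ q ∈ Finset.range (m + 1), (-1 : R) ^ q *
          ((MZV.shuffleWord (MZV.binaryWord (List.replicate (m - q) 2))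
            (MZV.binaryWord (List.replicate q 2))).map
              (f ∘ List.cons false ∘ List.cons false ∘ List.cons true ∘ List.cons true)).sum := by
  have h := twosAlt_alternating_sum_succ_succ
    (fun a b => ((MZV.shuffleWord (MZV.binaryWord (List.replicate a 2))
      (MZV.binaryWord (List.replicate b 2))).map f).sum)
    (fun a b => ((MZV.shuffleWord (MZV.binaryWord (List.replicate a 2))
      (MZV.binaryWord (List.replicate b 2))).map (f ∘ List.cons false ∘ List.cons true)).sum)
    (fun a b => ((MZV.shuffleWord (true :: MZV.binaryWord (List.replicate a 2))
      (true :: MZV.binaryWord (List.replicate b 2))).map (f ∘ List.cons false ∘ List.cons false)).sum)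
    (f (MZV.binaryWord (List.replicate (m + 2) 2))) m
    (fun a b => twosAlt_sum_shuffleWord_twos_succ_succ f a b)
    (by simp [MZV.binaryWord]) (by simp [MZV.binaryWord])
    (by simp [MZV.binaryWord, MZV.binaryWord_replicate_two_succ])
    (by simp [MZV.binaryWord, MZV.binaryWord_replicate_two_succ])
  rw [h, twosAlt_sum_alternating_P (f ∘ List.cons false ∘ List.cons false) m]
  simp only [Function.comp_assoc]
  ring

/-- `σ₀ = 1` over `R`: `∑_{q ≤ 0} (-1)^q [(AB)^{0-q} ш (AB)^q] = f(∅)`. [folklore] -/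
theorem twosAlt_sum_alternating_S_zero :
    ∑ q ∈ Finset.range (0 + 1), (-1 : R) ^ q *
        ((MZV.shuffleWord (MZV.binaryWord (List.replicate (0 - q) 2))
          (MZV.binaryWord (List.replicate q 2))).map f).sum = f [] := by
  simp [MZV.binaryWord]

omit f in
/-- **Corollary 1 of [BBBL1998, §4]** over `R` (`σ_{2n} = (-4)ⁿ (A²B²)ⁿ`): for every
`f : List Bool → R`, `∑_{q=0}^{2n} (-1)^q ∑_{W ∈ (AB)^{2n-q} ш (AB)^q} f(W) = (-4)ⁿ f((A²B²)ⁿ)`.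
[cite: BBBL1998, §4 Corollary 1] -/
theorem twosAlt_sum_shuffleWord_twos_alternating (n : ℕ) : ∀ f : List Bool → R,
    ∑ q ∈ Finset.range (2 * n + 1), (-1 : R) ^ q *
        ((MZV.shuffleWord (MZV.binaryWord (List.replicate (2 * n - q) 2))
          (MZV.binaryWord (List.replicate q 2))).map f).sum =
      (-4 : R) ^ n * f (MZV.binaryWord (List.replicate n [3, 1]).flatten) := by
  induction n with
  | zero =>
    intro f
    rw [Nat.mul_zero, twosAlt_sum_alternating_S_zero, pow_zero, one_mul]
    rfl
  | succ n ih =>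
    intro f
    rw [show 2 * (n + 1) = 2 * n + 2 by ring, twosAlt_sum_alternating_S_succ_succ f (2 * n),
      ih (f ∘ List.cons false ∘ List.cons false ∘ List.cons true ∘ List.cons true),
      MZV.binaryWord_threeOne_succ]
    simp only [Function.comp_apply]
    ring

end TwosAlt

/-- **Stub (v) — the BBBL alternating shuffle identity over any commutative ring**:
`Σ_{q=0}^{2n} (-1)^q Σ_{W ∈ (AB)^{2n-q} ш (AB)^q} f(W) = (-4)ⁿ f((A²B²)ⁿ)` for every `f : {words} → R`
(`(AB)ᵖ = binaryWord {2}ᵖ`, `(A²B²)ⁿ = binaryWord {3,1}ⁿ`; the tree theorem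
`MZV.sum_shuffleWord_twos_alternating` is the case of `ℝ`-valued `f`). [cite: BBBL1998, §4 Corollary 1] -/
theorem stub_shuffleTwosAlternating :
    ∀ (R : Type) [CommRing R] (f : List Bool → R) (n : ℕ),
      ∑ q ∈ Finset.range (2 * n + 1), (-1 : R) ^ q *
          ((MZV.shuffleWord (MZV.binaryWord (List.replicate (2 * n - q) 2))
            (MZV.binaryWord (List.replicate q 2))).map f).sum =
        (-4 : R) ^ n * f (MZV.binaryWord (List.replicate n [3, 1]).flatten) := by
  intro R _ f n
  exact twosAlt_sum_shuffleWord_twos_alternating n f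

end Summit.KontsevichZagierPeriods.FurushoPentagon.KernelModuloPeriodConjecture
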